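import Literature.AlgebraicGeometry.Frobenioids.BirationalizationProp44iiiIsotropicObjects
import HarnessLib

/-!
# Frobenioids I, Proposition 4.4 (iii): UNIQUENESS of `Φ^birat` in the repaired form — the subfunctor of
# groups of `Φ^gp` whose value at (the base of) every ISOTROPIC object is the image of `O^×(A^birat)` is unique

Mochizuki, *The geometry of Frobenioids I: the general theory*, Kyushu J. Math. **62** (2008)
293–400, §4, Proposition 4.4 (iii), kurims text p. 83 l. 25–32 ("There exists a UNIQUE subfunctor of
groups `Φ^birat ⊆ Φ^gp` such that … a surjection `O^×(A^birat) ↠ Φ^birat(A^birat)` …")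
[cite: MochizukiFrdI2008, Prop. 4.4 (iii) p.83].

PROOF-ONLY file (seat abc-iut-w4-d020), completing the record of node FrdI:Prop4.4(iii): as printed the
proposition is false twice over (surjectivity at non-isotropic objects, `…Prop44iiiCounterexample.lean`,
erratum E-15; the factorization clause for all arrows of `C^birat`, `…Prop44iiiFactorizationCounterexample.lean`,
finding F-w4d020-2). The REPAIRED statement C′ — "there is a unique subfunctor of groups `Φ^birat ⊆ Φ^gp`
such that for every ISOTROPIC `A` the divisor map `O^×(A^birat) → Φ^gp(Base A)` has image `Φ^birat(Base A)`
(and kernel the image of `O^×(A)`)" — holds for EVERY Frobenioid: existence and the surjections are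
`BirationalizationProp44iiiIsotropicObjects.lean` (`prop44iii_at_isIsotropic` for abc-iut-L1-t5's canonical
`biratSubfunctor`); this file proves the UNIQUENESS half:
* `GpSubfunctor.carrier_eq_of_iso` — a subfunctor of groups of `Φ^gp` is determined at `X` by its value at
  any `Y ≅ X` (pull back along the isomorphism both ways);
* `exists_isIsotropic_baseIso` — every `X ∈ Ob(D)` is isomorphic to the base of an ISOTROPIC object (Def. 1.3
  (i)(a): a Frobenius-trivial `A₀` with `Base A₀ ≅ X`; Def. 1.3 (vii)(a): its isotropic hull, over the same base);
* `biratSubfunctor_unique` — a subfunctor `Ψ` of `Φ^gp` with `Ψ(Base A) =` (germs at `A`) `=` (image of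
  `O^×(A^birat)`) for every isotropic `A` coincides with `biratSubfunctor F` at every `X ∈ Ob(D)`;
  `biratSubfunctor_unique_range` — the same with the hypothesis phrased through the divisor map
  `biratDivHom` of THE birationalization.
No statement of the paper is strengthened; nothing here bears on the disputed parts of [IUTchIII].
-/

namespace Literature.AlgebraicGeometry.Frobenioids

open CategoryTheory Opposite

namespace PreFrobenioid

universe w v v' u u'

variable {D : Type u} [Category.{v} D] {Φ : Dᵒᵖ ⥤ CommMonCat.{w}}
  {C : Type u'} [Category.{v'} C] {F : C ⥤ ElemFrobenioid Φ}

/-- A subfunctor of groups of `Φ^gp` is determined at `X` by its value at any isomorphic `Y`: if two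
subfunctors agree at `Y` and `ι : X ≅ Y`, they agree at `X`. [cite: MochizukiFrdI2008, Prop. 4.4 (iii) p.83] -/
theorem GpSubfunctor.carrier_eq_of_iso (Ψ Ψ' : GpSubfunctor Φ) {X Y : D} (ι : X ≅ Y)
    (h : Ψ.carrier Y = Ψ'.carrier Y) : Ψ.carrier X = Ψ'.carrier X := by
  ext c
  constructor
  · intro hc
    have h1 : pullGp Φ ι.inv c ∈ Ψ'.carrier Y := by rw [← h]; exact Ψ.pull_mem ι.inv hc
    have h2 := Ψ'.pull_mem ι.hom h1
    rwa [← pullGp_comp, ι.hom_inv_id, pullGp_id] at h2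
  · intro hc
    have h1 : pullGp Φ ι.inv c ∈ Ψ.carrier Y := by rw [h]; exact Ψ'.pull_mem ι.inv hc
    have h2 := Ψ.pull_mem ι.hom h1
    rwa [← pullGp_comp, ι.hom_inv_id, pullGp_id] at h2

/-- Every object of the base is isomorphic to the base of an ISOTROPIC object of a Frobenioid: take a
Frobenius-trivial object over it (Def. 1.3 (i)(a)) and pass to its isotropic hull (Def. 1.3 (vii)(a)), an
isometric pre-step, in particular a base-isomorphism. [cite: MochizukiFrdI2008, Def. 1.3 p.24] -/
theorem exists_isIsotropic_baseIso (hF : IsFrobenioid F) (X : D) :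
    ∃ A : C, IsIsotropic F A ∧ Nonempty (X ≅ baseObj F A) := by
  obtain ⟨A₀, -, ⟨e⟩⟩ := hF.i_a X
  haveI : IsIso (Base F (hullHom hF A₀)) := (isIsotropicHull_hullHom hF A₀).2.1.2
  exact ⟨hullObj hF A₀, (isIsotropicHull_hullHom hF A₀).2.2.1,
    ⟨e.symm ≪≫ asIso (Base F (hullHom hF A₀))⟩⟩

/-- **Uniqueness of `Φ^birat` (repaired Prop. 4.4 (iii))**: a subfunctor of groups `Ψ ⊆ Φ^gp` whose value
at the base of every ISOTROPIC object `A` is the set of birational germs at `A` (= the image of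
`O^×(A^birat) → Φ^gp(Base A)`, `range_biratDivHom`) coincides with abc-iut-L1-t5's canonical `biratSubfunctor F`
at every object of `D`. [cite: MochizukiFrdI2008, Prop. 4.4 (iii) p.83] -/
theorem biratSubfunctor_unique (hF : IsFrobenioid F) (Ψ : GpSubfunctor Φ)
    (hΨ : ∀ A : C, IsIsotropic F A → (Ψ.carrier (baseObj F A) : Set _) = biratGerms F A) (X : D) :
    Ψ.carrier X = (biratSubfunctor F).carrier X := by
  obtain ⟨A, hA, ⟨ι⟩⟩ := exists_isIsotropic_baseIso hF X
  apply GpSubfunctor.carrier_eq_of_iso Ψ (biratSubfunctor F) ι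
  apply SetLike.coe_injective
  rw [hΨ A hA]
  exact (coe_biratSubgroup_eq_biratGerms_of_isIsotropic hF hA).symm

/-- The same uniqueness with the hypothesis stated through the divisor map of THE birationalization: if
`Ψ(Base A)` is the IMAGE of `O^×(A^birat) → Φ^gp(Base A)` for every isotropic `A`, then `Ψ = Φ^birat`.
[cite: MochizukiFrdI2008, Prop. 4.4 (iii) p.83] -/
theorem biratSubfunctor_unique_range (hF : IsFrobenioid F) (hsq : HasBiratSquares F) (Ψ : GpSubfunctor Φ)
    (hΨ : ∀ A : C, IsIsotropic F A →
      (Ψ.carrier (baseObj F A) : Set _) = Set.range (biratDivHom hF hsq A)) (X : D) :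
    Ψ.carrier X = (biratSubfunctor F).carrier X :=
  biratSubfunctor_unique hF Ψ (fun A hA => by rw [hΨ A hA, range_biratDivHom hsq A]) X

/-- **The repaired Prop. 4.4 (iii) in full (existence + uniqueness)**, for EVERY Frobenioid: the canonical
`Φ^birat` has, at the base of each isotropic `A`, exactly the image of `O^×(A^birat)` with kernel the image of
`O^×(A)` (`prop44iii_at_isIsotropic`), and it is the ONLY subfunctor of groups of `Φ^gp` with those images.
[cite: MochizukiFrdI2008, Prop. 4.4 (iii) p.83] -/
theorem prop44iii_repaired (hF : IsFrobenioid F) (hsq : HasBiratSquares F) :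
    (∀ A : C, IsIsotropic F A →
      ((biratSubfunctor F).carrier (baseObj F A) : Set _) = Set.range (biratDivHom hF hsq A) ∧
        ∀ u : (biratOps hF hsq).unitsSubgroup ((toBirat F hF hsq).obj A),
          biratDivHom hF hsq A u = 1 ↔
            ∃ α : Aut A, α ∈ unitsSubgroup F A ∧
              (toBirat F hF hsq).mapIso α = (u : Aut ((toBirat F hF hsq).obj A))) ∧
    ∀ Ψ : GpSubfunctor Φ,
      (∀ A : C, IsIsotropic F A → (Ψ.carrier (baseObj F A) : Set _) = Set.range (biratDivHom hF hsq A)) →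
        ∀ X : D, Ψ.carrier X = (biratSubfunctor F).carrier X :=
  ⟨fun A hA => ⟨by rw [range_biratDivHom hsq A]; exact coe_biratSubgroup_eq_biratGerms_of_isIsotropic hF hA,
      fun u => biratDivHom_eq_one_iff hsq u⟩,
    fun Ψ hΨ X => biratSubfunctor_unique_range hF hsq Ψ hΨ X⟩

end PreFrobenioid

end Literature.AlgebraicGeometry.Frobenioids
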